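import Summits.KontsevichZagierPeriods.KontsevichZagierPeriods.Theorems.TerasomaMultiplicationBetaCancellationStubCatalystAlgebraicPoint

/-!
# `BetaCancellation` (stmt-KontsevichZagierPeriods-13633), line `dirichlet-companion-to-pi` — stub `stub_catalyticIntegrandAdd`

**Catalytic integrand additivity descends.** Fix a catalyst `p = [K, g]` of dimension `d` with
`p.value ≠ 0` and a *pinned-product family* `P n r = p ⊗ r` (dimension `d + n`): the domain of
`P n r` is `{z | head z ∈ K ∧ tail z ∈ r.domain}` and its integrand is
`z ↦ g (head z) · r.integrand (tail z)`, where `head z = (z (Fin.castAdd n i))ᵢ` and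
`tail z = (z (Fin.natAdd d j))ⱼ`. If three members `P n r, P n r₁, P n r₂` of the family satisfy the
hypotheses of the integrand-additivity move (1b) of the Kontsevich–Zagier calculus (same domain,
`(P n r).integrand = (P n r₁).integrand + (P n r₂).integrand` on it), then so do the bases: the
formal combination `[r] − [r₁] − [r₂]` is an integrand-additivity instance, hence a relation.

Proof. By `stub_catalyst_algebraicPoint` there is `x₀ ∈ K` with `c₀ = g x₀ ≠ 0`. Slice everything
along the catalyst fibre through `x₀`: for `w ∈ ℝⁿ` the point `Fin.append x₀ w` has head `x₀` and
tail `w` (`Fin.append_left`, `Fin.append_right`), so `w ∈ rᵢ.domain ↔ Fin.append x₀ w ∈ (P n rᵢ).domain`,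
and equality of the product domains gives equality of the base domains. On `r.domain` the
additivity identity at `Fin.append x₀ w` reads `c₀ · r.integrand w = c₀ · r₁.integrand w + c₀ · r₂.integrand w`;
cancelling `c₀ ≠ 0` gives `r.integrand = r₁.integrand + r₂.integrand` on `r.domain`. Conclude with
`KZ.integrandAddRel_subset_relations`. No definitions; sorry-free;
axioms ⊆ {propext, Classical.choice, Quot.sound}.

References: M. Kontsevich, D. Zagier, *Periods* (2001), §1.2 rule (1); A. Huber, S. Müller-Stach,
*Periods and Nori Motives* (2017), §13.1.
-/

noncomputable section

-- `Summit.KontsevichZagierPeriods.KontsevichZagierPeriods.…` is the tree's mandated layout (single-conjunct summit).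
set_option linter.dupNamespace false

namespace Summit.KontsevichZagierPeriods.KontsevichZagierPeriods.BetaCancellationLine

open Set
open Literature.NumberTheory.Transcendental
open Literature.NumberTheory.Transcendental.KZ

/-! ### Slicing a pinned product along a catalyst fibre -/

/-- **Domain slice of a pinned product.** For a pinned-product family `P n r = p ⊗ r` (domain
`{z | head z ∈ p.domain ∧ tail z ∈ r.domain}`) and a point `x₀ ∈ p.domain`, the point
`Fin.append x₀ w` lies in `(P n r).domain` iff `w ∈ r.domain`. [folklore] -/
theorem catalyticProduct_append_mem_domain_iff {d : ℕ} (p : IntegralRep d)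
    (P : ∀ n : ℕ, IntegralRep n → IntegralRep (d + n))
    (hPd : ∀ (n : ℕ) (r : IntegralRep n), (P n r).domain =
      {z | (fun i => z (Fin.castAdd n i)) ∈ p.domain ∧ (fun j => z (Fin.natAdd d j)) ∈ r.domain})
    {x₀ : Fin d → ℝ} (hx₀ : x₀ ∈ p.domain) {n : ℕ} (r : IntegralRep n) (w : Fin n → ℝ) :
    Fin.append x₀ w ∈ (P n r).domain ↔ w ∈ r.domain := by
  rw [hPd]
  simp [hx₀]

/-- **Base domains are read off the product domains.** For a pinned-product family `P n r = p ⊗ r`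
over a catalyst with non-empty domain (`x₀ ∈ p.domain`), if `(P n r₁).domain = (P n r).domain`
then `r₁.domain = r.domain` (slice along the fibre through `x₀`). [folklore] -/
theorem catalyticProduct_domain_eq_of_eq {d : ℕ} (p : IntegralRep d)
    (P : ∀ n : ℕ, IntegralRep n → IntegralRep (d + n))
    (hPd : ∀ (n : ℕ) (r : IntegralRep n), (P n r).domain =
      {z | (fun i => z (Fin.castAdd n i)) ∈ p.domain ∧ (fun j => z (Fin.natAdd d j)) ∈ r.domain})
    {x₀ : Fin d → ℝ} (hx₀ : x₀ ∈ p.domain) {n : ℕ} {r r₁ : IntegralRep n}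
    (h : (P n r₁).domain = (P n r).domain) : r₁.domain = r.domain := by
  ext w
  rw [← catalyticProduct_append_mem_domain_iff p P hPd hx₀ r₁ w,
    ← catalyticProduct_append_mem_domain_iff p P hPd hx₀ r w, h]

/-- **Integrand slice of a pinned product.** For a pinned-product family `P n r = p ⊗ r`
(integrand `z ↦ p.integrand (head z) * r.integrand (tail z)`), the integrand of `P n r` at
`Fin.append x₀ w` is `p.integrand x₀ * r.integrand w`. [folklore] -/
theorem catalyticProduct_integrand_append {d : ℕ} (p : IntegralRep d)
    (P : ∀ n : ℕ, IntegralRep n → IntegralRep (d + n))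
    (hPi : ∀ (n : ℕ) (r : IntegralRep n), (P n r).integrand =
      fun z => p.integrand (fun i => z (Fin.castAdd n i)) * r.integrand (fun j => z (Fin.natAdd d j)))
    (x₀ : Fin d → ℝ) {n : ℕ} (r : IntegralRep n) (w : Fin n → ℝ) :
    (P n r).integrand (Fin.append x₀ w) = p.integrand x₀ * r.integrand w := by
  rw [hPi]
  simp

/-! ### The stub -/

/-- STUB (seat c14, cycle 3). **Catalytic integrand additivity descends**: for a catalyst `p` with
`p.value ≠ 0` and a pinned-product family `P n r = p ⊗ r` (domain
`{z | head z ∈ p.domain ∧ tail z ∈ r.domain}`, integrand `p.integrand (head z) * r.integrand (tail z)`),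
an integrand-additivity instance among `P n r, P n r₁, P n r₂` (same domain,
`(P n r).integrand = (P n r₁).integrand + (P n r₂).integrand` on it) descends to
`[r] − [r₁] − [r₂] ∈ relations`: read domains and integrands along the catalyst fibre through a
point `x₀ ∈ p.domain` with `p.integrand x₀ ≠ 0` (`stub_catalyst_algebraicPoint`) and cancel
`p.integrand x₀`; the result is an integrand-additivity instance among the bases.
[cite: KontsevichZagier2001, §1.2 rule (1)] -/
theorem stub_catalyticIntegrandAdd {d : ℕ} (p : IntegralRep d) (hp : p.value ≠ 0)
    (P : ∀ n : ℕ, IntegralRep n → IntegralRep (d + n))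
    (hPd : ∀ (n : ℕ) (r : IntegralRep n), (P n r).domain =
      {z | (fun i => z (Fin.castAdd n i)) ∈ p.domain ∧ (fun j => z (Fin.natAdd d j)) ∈ r.domain})
    (hPi : ∀ (n : ℕ) (r : IntegralRep n), (P n r).integrand =
      fun z => p.integrand (fun i => z (Fin.castAdd n i)) * r.integrand (fun j => z (Fin.natAdd d j)))
    {n : ℕ} (r r₁ r₂ : IntegralRep n)
    (hd₁ : (P n r₁).domain = (P n r).domain) (hd₂ : (P n r₂).domain = (P n r).domain)
    (hadd : Set.EqOn (P n r).integrand ((P n r₁).integrand + (P n r₂).integrand) (P n r).domain) :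
    of r - of r₁ - of r₂ ∈ relations := by
  obtain ⟨x₀, hx₀, -, hc₀⟩ := stub_catalyst_algebraicPoint p hp
  refine integrandAddRel_subset_relations ⟨n, r, r₁, r₂,
    catalyticProduct_domain_eq_of_eq p P hPd hx₀ hd₁,
    catalyticProduct_domain_eq_of_eq p P hPd hx₀ hd₂, fun w hw => ?_, rfl⟩
  have hz : Fin.append x₀ w ∈ (P n r).domain :=
    (catalyticProduct_append_mem_domain_iff p P hPd hx₀ r w).2 hw
  have h := hadd hz
  rw [Pi.add_apply, catalyticProduct_integrand_append p P hPi x₀ r w,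
    catalyticProduct_integrand_append p P hPi x₀ r₁ w,
    catalyticProduct_integrand_append p P hPi x₀ r₂ w, ← mul_add] at h
  rw [Pi.add_apply]
  exact mul_left_cancel₀ hc₀ h

end Summit.KontsevichZagierPeriods.KontsevichZagierPeriods.BetaCancellationLine

end
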